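import Mathlib

/-!
# Stub `envelopePath` of line `finite-size-envelope`, crux `CriticalPathRSW` — core: the envelope path

Pure real analysis on the unit square, no percolation.  `env_exists_path`: if `K ⊆ [0,1]²` is
closed with interval (order-connected) vertical fibres, contains the graph over `[0,1]` of a
function `g` with `g - C·ρ` antitone (`C ≥ 0`, `g 0 ≤ ½`), and contains `(0,½)` and `(1,0)`, then
there is a continuous `γ : [0,1] → K` from `(1,0)` to `(0,½)` with both coordinates of bounded
variation.

Construction: `F ρ := (C+1)·ρ - g ρ` has unit gaps on `[0,1]` (`F ρ' - F ρ ≥ ρ' - ρ`), its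
generalised inverse `G t := sSup {ρ ∈ [0,1] | F ρ ≤ t}` is monotone and 1-Lipschitz, and
`t ↦ (G t, (C+1)·G t - t)` on `[-½, C+1]` traces the two endpoint segments, the graph of `g`, and a
vertical connector across every (downward) jump of `g`; each point is squeezed into `K` between a
`K`-point above (compactness from the left, or `(0,½)`) and one below (from the right, or `(1,0)`)
using the interval fibre.  The parameter is then run backwards over `unitInterval`.

Design: no definitions are introduced — `F` is written out and the generalised inverse enters the
lemmas as an arbitrary function `G` together with its defining equation `hG`, so that the file is
a list of theorems only.  Also here: subadditivity of `eVariationOn` under pointwise addition and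
the order-dual of `MonotoneOn.boundedVariationOn`.

Adapted from the crux disprover's `Disproof.lean` (refuter-cdisprove-stmt-CriticalPhenomena-10267-0,
§8–§9, namespace `EnvelopePath`), item evidence 2026-08-16.
-/

namespace Summit.CriticalPhenomena.CardyFormulaZ2.Cruxes.CriticalPathRSW.FiniteSizeEnvelope

open Set MeasureTheory Filter Topology

-- adapted from the crux disprover's Disproof.lean (refuter-cdisprove-stmt-CriticalPhenomena-10267-0), item evidence 2026-08-16

/-! ## Bounded-variation bookkeeping -/

/-- Subadditivity of the extended variation under pointwise addition of real functions:
`V(f + g; s) ≤ V(f; s) + V(g; s)` (termwise triangle inequality on every partition sum). -/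
theorem env_eVariationOn_add_le {α : Type*} [LinearOrder α] (f g : α → ℝ) (s : Set α) :
    eVariationOn (f + g) s ≤ eVariationOn f s + eVariationOn g s := by
  refine iSup_le fun p => ?_
  calc ∑ i ∈ Finset.range p.1, edist ((f + g) (p.2.1 (i + 1))) ((f + g) (p.2.1 i))
      ≤ ∑ i ∈ Finset.range p.1,
          (edist (f (p.2.1 (i + 1))) (f (p.2.1 i)) + edist (g (p.2.1 (i + 1))) (g (p.2.1 i))) :=
        Finset.sum_le_sum fun i _ => edist_add_add_le _ _ _ _
    _ = (∑ i ∈ Finset.range p.1, edist (f (p.2.1 (i + 1))) (f (p.2.1 i))) +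
          ∑ i ∈ Finset.range p.1, edist (g (p.2.1 (i + 1))) (g (p.2.1 i)) :=
        Finset.sum_add_distrib
    _ ≤ eVariationOn f s + eVariationOn g s :=
        add_le_add (eVariationOn.sum_le p.2.2.1 p.2.2.2) (eVariationOn.sum_le p.2.2.1 p.2.2.2)

/-- A bounded antitone real function has bounded variation (order-dual of
`MonotoneOn.boundedVariationOn`). -/
theorem env_antitoneOn_boundedVariationOn {α : Type*} [LinearOrder α] {f : α → ℝ} {s : Set α}
    {C : ℝ} (hf : AntitoneOn f s) (h : ∀ x ∈ s, |f x| ≤ C) : BoundedVariationOn f s := by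
  have hm : MonotoneOn (f ∘ OrderDual.ofDual) (OrderDual.ofDual ⁻¹' s) :=
    fun x hx y hy hxy => hf hy hx hxy
  have hb : BoundedVariationOn (f ∘ OrderDual.ofDual) (OrderDual.ofDual ⁻¹' s) :=
    hm.boundedVariationOn (C := C) fun x hx => h _ hx
  simpa [BoundedVariationOn, eVariationOn.comp_ofDual] using hb

/-! ## The envelope path

Throughout, `F ρ` stands for `(C + 1) * ρ - g ρ` (written out) and `G` is any function satisfying
`hG : ∀ t, G t = sSup {ρ | ρ ∈ Icc 0 1 ∧ (C + 1) * ρ - g ρ ≤ t}` (the generalised inverse of `F`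
on `[0,1]`). -/

section EnvelopePath

variable {g : ℝ → ℝ} {C : ℝ} {G : ℝ → ℝ}

/-- Unit gaps of `F ρ = (C+1)ρ - g ρ` on `[0,1]`: `F ρ + (ρ' - ρ) ≤ F ρ'` for `ρ ≤ ρ'`, when
`g - C·id` is antitone. -/
theorem env_F_gap (hanti : AntitoneOn (fun ρ => g ρ - C * ρ) (Icc 0 1)) {ρ ρ' : ℝ}
    (hρ : ρ ∈ Icc (0:ℝ) 1) (hρ' : ρ' ∈ Icc (0:ℝ) 1) (h : ρ ≤ ρ') :
    ((C + 1) * ρ - g ρ) + (ρ' - ρ) ≤ (C + 1) * ρ' - g ρ' := by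
  have := hanti hρ hρ' h
  simp only at this
  linarith

/-- The sublevel sets `{ρ ∈ [0,1] | F ρ ≤ t}` are bounded above (by `1`). -/
theorem env_bddAbove_S (t : ℝ) : BddAbove {ρ | ρ ∈ Icc (0:ℝ) 1 ∧ (C + 1) * ρ - g ρ ≤ t} :=
  ⟨1, fun _ hρ => hρ.1.2⟩

/-- The generalised inverse `G` takes values in `[0,1]`. -/
theorem env_G_mem (hG : ∀ t, G t = sSup {ρ | ρ ∈ Icc (0:ℝ) 1 ∧ (C + 1) * ρ - g ρ ≤ t}) (t : ℝ) :
    G t ∈ Icc (0:ℝ) 1 := by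
  rw [hG]
  exact ⟨Real.sSup_nonneg (fun _ hρ => hρ.1.1), Real.sSup_le (fun _ hρ => hρ.1.2) zero_le_one⟩

/-- Below `G t` the function `F` is `≤ t`. -/
theorem env_F_le_of_lt_G (hG : ∀ t, G t = sSup {ρ | ρ ∈ Icc (0:ℝ) 1 ∧ (C + 1) * ρ - g ρ ≤ t})
    (hanti : AntitoneOn (fun ρ => g ρ - C * ρ) (Icc 0 1)) {t ρ : ℝ}
    (hρ : ρ ∈ Icc (0:ℝ) 1) (h : ρ < G t) : (C + 1) * ρ - g ρ ≤ t := by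
  rw [hG] at h
  have hne : ({ρ | ρ ∈ Icc (0:ℝ) 1 ∧ (C + 1) * ρ - g ρ ≤ t}).Nonempty := by
    by_contra hem
    rw [Set.not_nonempty_iff_eq_empty] at hem
    rw [hem, Real.sSup_empty] at h
    exact absurd hρ.1 (not_le.mpr h)
  obtain ⟨ρ', hρ'S, hlt⟩ := exists_lt_of_lt_csSup hne h
  have := env_F_gap hanti hρ hρ'S.1 hlt.le
  linarith [hρ'S.2]

/-- Above `G t` the function `F` is `> t`. -/
theorem env_lt_F_of_G_lt (hG : ∀ t, G t = sSup {ρ | ρ ∈ Icc (0:ℝ) 1 ∧ (C + 1) * ρ - g ρ ≤ t})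
    {t ρ : ℝ} (hρ : ρ ∈ Icc (0:ℝ) 1) (h : G t < ρ) : t < (C + 1) * ρ - g ρ := by
  by_contra hle
  have : ρ ≤ G t := by
    rw [hG]
    exact le_csSup (env_bddAbove_S t) ⟨hρ, not_lt.mp hle⟩
  linarith

/-- `G` is monotone. -/
theorem env_G_mono (hG : ∀ t, G t = sSup {ρ | ρ ∈ Icc (0:ℝ) 1 ∧ (C + 1) * ρ - g ρ ≤ t}) :
    Monotone G := by
  intro t t' htt'
  by_cases hne : ({ρ | ρ ∈ Icc (0:ℝ) 1 ∧ (C + 1) * ρ - g ρ ≤ t}).Nonempty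
  · rw [hG t, hG t']
    exact csSup_le_csSup (env_bddAbove_S t') hne (fun _ hρ => ⟨hρ.1, hρ.2.trans htt'⟩)
  · rw [Set.not_nonempty_iff_eq_empty] at hne
    have : G t = 0 := by rw [hG t, hne, Real.sSup_empty]
    rw [this]
    exact (env_G_mem hG t').1

/-- One-sided slope control of `G` (unit gaps of `F`): `G t' ≤ G t + (t' - t)` for `t ≤ t'`. -/
theorem env_G_sub_le (hG : ∀ t, G t = sSup {ρ | ρ ∈ Icc (0:ℝ) 1 ∧ (C + 1) * ρ - g ρ ≤ t})
    (hanti : AntitoneOn (fun ρ => g ρ - C * ρ) (Icc 0 1)) {t t' : ℝ} (htt' : t ≤ t') :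
    G t' ≤ G t + (t' - t) := by
  by_contra hlt
  have hlt := lt_of_not_ge hlt
  -- pick ρ with G t + (t'-t) < ρ < G t'
  obtain ⟨ρ, hρ1, hρ2⟩ := exists_between hlt
  -- pick ρ₁ with G t < ρ₁ < ρ - (t'-t)
  have hgap : G t < ρ - (t' - t) := by linarith
  obtain ⟨ρ₁, hρ₁1, hρ₁2⟩ := exists_between hgap
  have hGt := env_G_mem hG t
  have hGt' := env_G_mem hG t'
  have hρI : ρ ∈ Icc (0:ℝ) 1 := ⟨by linarith [hGt.1], by linarith [hGt'.2]⟩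
  have hρ₁I : ρ₁ ∈ Icc (0:ℝ) 1 := ⟨by linarith [hGt.1], by linarith [hGt'.2]⟩
  have h1 : t < (C + 1) * ρ₁ - g ρ₁ := env_lt_F_of_G_lt hG hρ₁I hρ₁1
  have h2 : (C + 1) * ρ - g ρ ≤ t' := env_F_le_of_lt_G hG hanti hρI hρ2
  have h3 := env_F_gap hanti hρ₁I hρI (by linarith)
  linarith

/-- `G` is 1-Lipschitz (monotone with one-sided unit slope control). -/
theorem env_G_lipschitz (hG : ∀ t, G t = sSup {ρ | ρ ∈ Icc (0:ℝ) 1 ∧ (C + 1) * ρ - g ρ ≤ t})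
    (hanti : AntitoneOn (fun ρ => g ρ - C * ρ) (Icc 0 1)) : LipschitzWith 1 G := by
  refine LipschitzWith.of_dist_le_mul fun t t' => ?_
  rw [NNReal.coe_one, one_mul, Real.dist_eq, Real.dist_eq, abs_sub_le_iff]
  rcases le_total t t' with h | h
  · have a := env_G_sub_le hG hanti h
    have b := env_G_mono hG h
    rw [abs_of_nonpos (by linarith)]
    constructor <;> linarith
  · have a := env_G_sub_le hG hanti h
    have b := env_G_mono hG h
    rw [abs_of_nonneg (by linarith)]
    constructor <;> linarith

variable {K : Set (ℝ × ℝ)}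

/-- Every point `(G t, (C+1)·G t - t)` of the envelope path, `t ∈ [-½, C+1]`, lies in `K`
(closedness of `K` + interval fibres): it is squeezed between a `K`-point above, obtained from the
graph of `g` to the left of `G t` by compactness (or `(0,½)` when `G t = 0`), and a `K`-point
below, obtained from the graph to the right (or `(1,0)` when `G t = 1`). -/
theorem env_pt_mem (hG : ∀ t, G t = sSup {ρ | ρ ∈ Icc (0:ℝ) 1 ∧ (C + 1) * ρ - g ρ ≤ t})
    (hK : IsClosed K) (hKsub : K ⊆ Icc 0 1 ×ˢ Icc 0 1)
    (hfib : ∀ ρ, Set.OrdConnected {c | (ρ, c) ∈ K})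
    (hg : ∀ ρ ∈ Icc (0:ℝ) 1, (ρ, g ρ) ∈ K) (hanti : AntitoneOn (fun ρ => g ρ - C * ρ) (Icc 0 1))
    (h0 : ((0:ℝ), (1/2:ℝ)) ∈ K) (h1 : ((1:ℝ), (0:ℝ)) ∈ K)
    {t : ℝ} (ht : t ∈ Icc (-1/2 : ℝ) (C + 1)) : (G t, (C + 1) * G t - t) ∈ K := by
  have hρ₀ : G t ∈ Icc (0:ℝ) 1 := env_G_mem hG t
  set ρ₀ := G t with hρ₀def
  -- a point of K above
  have hup : ∃ yhi, (C + 1) * ρ₀ - t ≤ yhi ∧ (ρ₀, yhi) ∈ K := by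
    rcases eq_or_lt_of_le hρ₀.1 with h0eq | hpos
    · refine ⟨1 / 2, ?_, ?_⟩
      · rw [← h0eq]; linarith [ht.1]
      · rw [← h0eq]; exact h0
    · let A := K ∩ {p : ℝ × ℝ | p.1 ≤ ρ₀ ∧ (C + 1) * p.1 - t ≤ p.2}
      have hAcl : IsClosed {p : ℝ × ℝ | p.1 ≤ ρ₀ ∧ (C + 1) * p.1 - t ≤ p.2} :=
        (isClosed_le continuous_fst continuous_const).inter
          (isClosed_le (by fun_prop) continuous_snd)
      have hAc : IsCompact A :=
        (isCompact_Icc.prod isCompact_Icc).of_isClosed_subset (hK.inter hAcl)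
          (Set.inter_subset_left.trans hKsub)
      have himg : IsClosed (Prod.fst '' A) := (hAc.image continuous_fst).isClosed
      have hsub : Ico 0 ρ₀ ⊆ Prod.fst '' A := by
        intro ρ hρ
        have hρI : ρ ∈ Icc (0:ℝ) 1 := ⟨hρ.1, hρ.2.le.trans hρ₀.2⟩
        have hF : (C + 1) * ρ - g ρ ≤ t := env_F_le_of_lt_G hG hanti hρI hρ.2
        refine ⟨(ρ, g ρ), ⟨hg ρ hρI, hρ.2.le, ?_⟩, rfl⟩
        show (C + 1) * ρ - t ≤ g ρ
        linarith
      have hmem : ρ₀ ∈ Prod.fst '' A := by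
        have hcl : ρ₀ ∈ closure (Ico 0 ρ₀) := by
          rw [closure_Ico hpos.ne]; exact right_mem_Icc.mpr hpos.le
        exact closure_minimal hsub himg hcl
      obtain ⟨p, hpA, hp1⟩ := hmem
      refine ⟨p.2, ?_, ?_⟩
      · have := hpA.2.2; rw [hp1] at this; exact this
      · have : (p.1, p.2) ∈ K := hpA.1
        rwa [hp1] at this
  -- a point of K below
  have hlo : ∃ ylo, ylo ≤ (C + 1) * ρ₀ - t ∧ (ρ₀, ylo) ∈ K := by
    rcases eq_or_lt_of_le hρ₀.2 with h1eq | hlt1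
    · refine ⟨0, ?_, ?_⟩
      · rw [h1eq]; linarith [ht.2]
      · rw [h1eq]; exact h1
    · let A := K ∩ {p : ℝ × ℝ | ρ₀ ≤ p.1 ∧ p.2 ≤ (C + 1) * p.1 - t}
      have hAcl : IsClosed {p : ℝ × ℝ | ρ₀ ≤ p.1 ∧ p.2 ≤ (C + 1) * p.1 - t} :=
        (isClosed_le continuous_const continuous_fst).inter
          (isClosed_le continuous_snd (by fun_prop))
      have hAc : IsCompact A :=
        (isCompact_Icc.prod isCompact_Icc).of_isClosed_subset (hK.inter hAcl)
          (Set.inter_subset_left.trans hKsub)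
      have himg : IsClosed (Prod.fst '' A) := (hAc.image continuous_fst).isClosed
      have hsub : Ioc ρ₀ 1 ⊆ Prod.fst '' A := by
        intro ρ hρ
        have hρI : ρ ∈ Icc (0:ℝ) 1 := ⟨hρ₀.1.trans hρ.1.le, hρ.2⟩
        have hF : t < (C + 1) * ρ - g ρ := env_lt_F_of_G_lt hG hρI hρ.1
        refine ⟨(ρ, g ρ), ⟨hg ρ hρI, hρ.1.le, ?_⟩, rfl⟩
        show g ρ ≤ (C + 1) * ρ - t
        linarith
      have hmem : ρ₀ ∈ Prod.fst '' A := by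
        have hcl : ρ₀ ∈ closure (Ioc ρ₀ 1) := by
          rw [closure_Ioc hlt1.ne]; exact left_mem_Icc.mpr hlt1.le
        exact closure_minimal hsub himg hcl
      obtain ⟨p, hpA, hp1⟩ := hmem
      refine ⟨p.2, ?_, ?_⟩
      · have := hpA.2.2; rw [hp1] at this; exact this
      · have : (p.1, p.2) ∈ K := hpA.1
        rwa [hp1] at this
  obtain ⟨yhi, hyhi, hKhi⟩ := hup
  obtain ⟨ylo, hylo, hKlo⟩ := hlo
  exact (hfib ρ₀).out hKlo hKhi ⟨hylo, hyhi⟩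

/-- **The envelope path.** If `K ⊆ [0,1]²` is closed with interval (order-connected) fibres,
contains the graph of `g` over `[0,1]` where `g - C·id` is antitone (`C ≥ 0`), contains `(0,½)`
and `(1,0)`, and `g 0 ≤ ½`, then there is a continuous path `γ : [0,1] → K` from `(1,0)` to
`(0,½)` whose two coordinates have bounded variation: the completed graph of `g` (jumps bridged
vertically) between the two endpoint segments, parametrised backwards through the 1-Lipschitz
generalised inverse `G` of `F = (C+1)·id - g`. -/
theorem env_exists_path (hK : IsClosed K) (hKsub : K ⊆ Icc 0 1 ×ˢ Icc 0 1)
    (hfib : ∀ ρ, Set.OrdConnected {c | (ρ, c) ∈ K})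
    (hg : ∀ ρ ∈ Icc (0:ℝ) 1, (ρ, g ρ) ∈ K) (hC : 0 ≤ C)
    (hanti : AntitoneOn (fun ρ => g ρ - C * ρ) (Icc 0 1)) (hg0 : g 0 ≤ 1 / 2)
    (h0 : ((0:ℝ), (1/2:ℝ)) ∈ K) (h1 : ((1:ℝ), (0:ℝ)) ∈ K) :
    ∃ γ : unitInterval → ℝ × ℝ, Continuous γ ∧ γ 0 = (1, 0) ∧ γ 1 = (0, 1 / 2) ∧
      (∀ s, γ s ∈ K) ∧ BoundedVariationOn (fun s => (γ s).1) Set.univ ∧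
      BoundedVariationOn (fun s => (γ s).2) Set.univ := by
  -- the generalised inverse of `F`
  obtain ⟨G, hG⟩ : ∃ G : ℝ → ℝ, ∀ t, G t = sSup {ρ | ρ ∈ Icc (0:ℝ) 1 ∧ (C + 1) * ρ - g ρ ≤ t} :=
    ⟨_, fun _ => rfl⟩
  -- parameter change `τ s = (C+1) - (C + 3/2) s` from [0,1] onto [-1/2, C+1], decreasing
  let τ : unitInterval → ℝ := fun s => (C + 1) - (C + 3 / 2) * (s : ℝ)
  have hτmem : ∀ s : unitInterval, τ s ∈ Icc (-1/2 : ℝ) (C + 1) := by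
    intro s
    have h0 := s.2.1; have h1 := s.2.2
    constructor <;> simp only [τ] <;> nlinarith
  have hτanti : ∀ s s' : unitInterval, s ≤ s' → τ s' ≤ τ s := by
    intro s s' h
    have : (s : ℝ) ≤ (s' : ℝ) := h
    simp only [τ]; nlinarith
  -- G at the two ends
  have hGtop : G (C + 1) = 1 := by
    refine le_antisymm (env_G_mem hG _).2 ?_
    rw [hG]
    refine le_csSup (env_bddAbove_S _) ⟨⟨zero_le_one, le_rfl⟩, ?_⟩
    have hg1 : 0 ≤ g 1 := (hKsub (hg 1 ⟨zero_le_one, le_rfl⟩)).2.1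
    linarith
  have hGbot : G (-1 / 2) = 0 := by
    refine le_antisymm ?_ (env_G_mem hG _).1
    rw [hG]
    refine Real.sSup_le (fun ρ hρ => ?_) le_rfl
    have hgap := env_F_gap hanti ⟨le_rfl, zero_le_one⟩ hρ.1 hρ.1.1
    linarith [hρ.2]
  refine ⟨fun s => (G (τ s), (C + 1) * G (τ s) - τ s), ?_, ?_, ?_, ?_, ?_, ?_⟩
  · -- continuity
    have hτc : Continuous τ := by fun_prop
    have hGc : Continuous G := (env_G_lipschitz hG hanti).continuous
    fun_prop
  · -- γ 0 = (1, 0)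
    have : τ 0 = C + 1 := by simp [τ]
    simp only [this, hGtop]
    ext <;> simp
  · -- γ 1 = (0, 1/2)
    have : τ 1 = -1 / 2 := by simp [τ]; ring
    simp only [this, hGbot]
    ext <;> simp; ring
  · intro s
    exact env_pt_mem hG hK hKsub hfib hg hanti h0 h1 (hτmem s)
  · -- BV of the first coordinate: antitone and bounded
    refine env_antitoneOn_boundedVariationOn (C := 1)
      (fun s _ s' _ h => env_G_mono hG (hτanti s s' h)) ?_
    intro s _
    have hm := env_G_mem hG (τ s)
    show |G (τ s)| ≤ 1
    rw [abs_of_nonneg hm.1]; exact hm.2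
  · -- BV of the second coordinate: antitone part + monotone affine part
    have hsplit : (fun s : unitInterval => ((G (τ s), (C + 1) * G (τ s) - τ s) : ℝ × ℝ).2) =
        (fun s : unitInterval => (C + 1) * G (τ s)) +
          fun s : unitInterval => (C + 3 / 2) * (s : ℝ) - (C + 1) := by
      funext s; simp only [τ, Pi.add_apply]; ring
    rw [hsplit]
    have hA : BoundedVariationOn (fun s : unitInterval => (C + 1) * G (τ s)) Set.univ := by
      refine env_antitoneOn_boundedVariationOn (C := C + 1) ?_ ?_
      · intro s _ s' _ h
        exact mul_le_mul_of_nonneg_left (env_G_mono hG (hτanti s s' h)) (by linarith)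
      · intro s _
        have hm := env_G_mem hG (τ s)
        rw [abs_of_nonneg (mul_nonneg (by linarith) hm.1)]
        nlinarith [hm.2]
    have hB : BoundedVariationOn
        (fun s : unitInterval => (C + 3 / 2) * (s : ℝ) - (C + 1)) Set.univ := by
      refine MonotoneOn.boundedVariationOn (C := 2 * C + 3) ?_ ?_
      · intro s _ s' _ h
        have : (s : ℝ) ≤ (s' : ℝ) := h
        nlinarith
      · intro s _
        have h0 := s.2.1; have h1 := s.2.2
        rw [abs_le]; constructor <;> nlinarith
    exact ne_top_of_le_ne_top (ENNReal.add_ne_top.2 ⟨hA, hB⟩) (env_eVariationOn_add_le _ _ _)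

end EnvelopePath

/-- **Registered sub-goal `stub_envelopePath_core`** of stub `stub_envelopePath`: the closed form of
`env_exists_path` (all parameters explicit), registered on the crux item so that this helper file
lands with `--supports`; the stub file uses it through `env_exists_path`. -/
theorem stub_envelopePath_core :
  ∀ (K : Set (ℝ × ℝ)) (g : ℝ → ℝ) (C : ℝ), IsClosed K → K ⊆ Icc (0 : ℝ) 1 ×ˢ Icc (0 : ℝ) 1 →
    (∀ ρ : ℝ, Set.OrdConnected {c : ℝ | (ρ, c) ∈ K}) →
    (∀ ρ : ℝ, ρ ∈ Icc (0 : ℝ) 1 → (ρ, g ρ) ∈ K) → 0 ≤ C →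
    AntitoneOn (fun ρ : ℝ => g ρ - C * ρ) (Icc (0 : ℝ) 1) → g 0 ≤ 1 / 2 →
    ((0 : ℝ), (1 / 2 : ℝ)) ∈ K → ((1 : ℝ), (0 : ℝ)) ∈ K →
    ∃ γ : unitInterval → ℝ × ℝ, Continuous γ ∧ γ 0 = (1, 0) ∧ γ 1 = (0, 1 / 2) ∧
      (∀ s, γ s ∈ K) ∧ BoundedVariationOn (fun s => (γ s).1) univ ∧
      BoundedVariationOn (fun s => (γ s).2) univ :=
  fun _ _ _ hK hKsub hfib hg hC hanti hg0 h0 h1 => env_exists_path hK hKsub hfib hg hC hanti hg0 h0 h1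

end Summit.CriticalPhenomena.CardyFormulaZ2.Cruxes.CriticalPathRSW.FiniteSizeEnvelope
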